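import Literature.NumberTheory.ComplexMultiplication.CMTypeRankPairFlipStabilizers
import Summits.HodgeConjecture.CorCM.GenericSexticThreefoldTimesCMHodge
import Summits.HodgeConjecture.CorCM.SexticCMFieldPairFlip
import Summits.HodgeConjecture.CorCM.IndependentCMFieldsHodge
import HarnessLib

/-!
# Two simple CM abelian threefolds whose sextic CM fields have pair flips (Galois closure of degree `24` or `48`):
# `Hg(A₀ × A₁) = Hg(A₀) × Hg(A₁)` and the Hodge conjecture on every `A₀^a × A₁^b`, for ANY two non-isogenous ones

COR-CM (cell `pub-hodgecm2`, binder seat `b16` gen 41, count-neutral claim CM33-PAIRFLIP, file F4; theorems only, no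
definition, no named fact).  NEW as stated — the (3,3) partition of dimension six for the GENERIC member — hence under
`Summits/`.  The geometric face of `Literature/NumberTheory/ComplexMultiplication/CMTypeRankPairFlipStabilizers`
(two six-point pair-flip slots are rank-additive unless isomorphic as typed `G`-sets) and the sequel of
`CorCM/GenericSexticThreefoldTimesCMHodge` (pair-flip sextic field times a field of degree `≤ 4` or a sextic field with
an imaginary quadratic subfield) and of `CorCM/GenericCMFieldSameFieldFamiliesHodge` (p2: ONE pair-flip field).

* §1 **`isNondegenerateFamily_of_pairFlip_pair`** — two sextic CM fields `K_{i₀}`, `K_{i₁}` (equal, isomorphic or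
  not) BOTH with pair flips, and a SEPARATING pair of types (primitive, not CM-equivalent along a field isomorphism —
  on abelian varieties: simple and non-isogenous): the family is NONDEGENERATE.  Kubota separation excludes the typed
  isomorphism `Hom(K_{i₀}, ℂ) ≃ Hom(K_{i₁}, ℂ)` of the abstract theorem, so stabiliser separation applies.
* §2 On abelian varieties: **`isNondegenerateFamily_pairFlipSextic_pair_of_not_isIsogenous`**,
  **`hodgeConjectureFor_prod_pairFlipSextic_pair`** — for ANY two non-isogenous CM abelian threefolds `A₀`, `A₁` whose
  sextic CM fields both have pair flips: `Hg(A₀ × A₁) = Hg(A₀) × Hg(A₁)`, `B• = D•` and the Hodge conjecture on every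
  `⨁_{j<N} A_{π j}` (every `A₀^a × A₁^b`), UNCONDITIONALLY; `not_exists_exceptional_prod_pairFlipSextic_pair`.
* §3 BY NAME for Galois closures of degree `24` or `48` (`CorCM/SexticCMFieldPairFlip`):
  **`hodgeConjectureFor_prod_threefolds_of_finrank_normalClosure`** (both closures of degree `24`/`48`),
  **`hodgeConjectureFor_prod_threefolds_of_finrank_normalClosure_of_quadratic`** (one closure of degree `24`/`48`,
  the other field containing an imaginary quadratic field — the closure-`24`/`48` wrapper of file F2), and
  `hodgeConjectureFor_prod_small_threefold_of_finrank_normalClosure` (a CM elliptic curve or simple CM surface times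
  such a threefold).

NET (with F2): a simple CM abelian threefold whose sextic CM field has Galois closure of degree `24` or `48` is stably
nondegenerate together with EVERY non-isogenous simple CM abelian variety of dimension `≤ 3` — curves, surfaces,
threefolds with a cyclic or closure-`12` field (F2), threefolds with a closure-`24`/`48` field (this file): the Hodge
conjecture holds on all products of powers of the two.  (Two threefolds whose fields BOTH contain imaginary quadratic
fields are degenerate iff the quadratic fields coincide — `CorCM/SharedImaginaryQuadraticCMFieldsHodge`,
`CorCM/GaloisSexticThreefoldPairsHodge` for the Galois case.)

## References

* [Gordon1999HodgeAVSurvey] B. B. Gordon, *A survey of the Hodge conjecture for abelian varieties*, §3 Theorem, 7.4–7.7,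
  10.10.
* [Dodson1984] B. Dodson, *The structure of Galois groups of CM-fields*, Trans. AMS 283 (1984), §5.1.2.
* [Shimura1998] G. Shimura, *Abelian Varieties with Complex Multiplication and Modular Functions*, §8.2 Prop. 26.
* [MoonenZarhin1999LowDim] B. Moonen, Yu. Zarhin, *Hodge classes on abelian varieties of low dimension*, Math. Ann.
  315 (1999) (dimension `≤ 5`; this is a dimension-`6` analogue for products of two CM threefolds).
-/

noncomputable section

open CategoryTheory CategoryTheory.Limits NumberField Module

namespace Summit.HodgeConjecture.CorCM

open Literature.NumberTheory.ComplexMultiplication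
open Literature.AlgebraicGeometry.Motives (AbelianVariety CMType)
open Literature.AlgebraicGeometry.HodgeTheory
open Literature.AlgebraicGeometry.ComplexMultiplication (IsCMTypeRealisation isSimple_iff_isPrimitive)
open Literature.AlgebraicGeometry.VanGeemen1994 (hodgeClassSpan)
open Literature.AlgebraicGeometry.Pohlmann1968
open Literature.Barriers.HodgeConjecture (divisorClassesSpan)

variable {I : Type} {K : I → Type} [∀ i, Field (K i)] [∀ i, NumberField (K i)] [∀ i, IsCMField (K i)] [Fintype I]
  [DecidableEq I] [Nonempty I] {Φ : ∀ i, CMType (K i)}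

/-! ## §1 Types -/

section Types

/-- **Two sextic CM fields with pair flips and a separating pair of types: the family is nondegenerate**
(`rank(Φ₀, Φ₁) = 7`, `Hg = Hg × Hg`).  Kubota separation forbids an `Aut(ℂ)`-equivariant bijection
`Hom(K_{i₀}, ℂ) ≃ Hom(K_{i₁}, ℂ)` carrying `Φ_{i₀}` onto `Φ_{i₁}`, so `typeRank_sigmaType_eq_of_pairFlip_pair` applies.
[cite: Gordon1999HodgeAVSurvey, §3 Theorem and 7.4–7.5] [cite: Dodson1984, §5.1.2 Theorem] -/
theorem isNondegenerateFamily_of_pairFlip_pair {i₀ i₁ : I} (h01 : i₀ ≠ i₁) (hI : ∀ j, j = i₀ ∨ j = i₁)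
    (hflip : ∀ (i : I) (s : K i →+* ℂ), ∃ σ : ℂ ≃+* ℂ, σ • s = (starRingAut : ℂ ≃+* ℂ) • s ∧
      ∀ t : K i →+* ℂ, t ≠ s → t ≠ (starRingAut : ℂ ≃+* ℂ) • s → σ • t = t)
    (h6 : ∀ i, finrank ℚ (K i) = 6) (hsep : CMAlgebra.IsSeparatingFamily Φ) :
    CMAlgebra.IsNondegenerateFamily Φ := by
  classical
  haveI : ∀ i, MulAction.IsPretransitive (ℂ ≃+* ℂ) (K i →+* ℂ) := fun i => isPretransitive_ringEquiv_complex
  have hcard : ∀ i, Fintype.card (K i →+* ℂ) = 6 := fun i => by rw [Embeddings.card, h6]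
  have hne : ∀ β : (K i₀ →+* ℂ) ≃ (K i₁ →+* ℂ), (∀ (g : ℂ ≃+* ℂ) (x : K i₀ →+* ℂ), β (g • x) = g • β x) →
      ∃ x : K i₀ →+* ℂ, ¬(β x ∈ (Φ i₁).1 ↔ x ∈ (Φ i₀).1) := by
    intro β hβ
    by_contra hall
    push Not at hall
    obtain ⟨x⟩ : Nonempty (K i₀ →+* ℂ) := inferInstance
    have heq := (CMAlgebra.isSeparatingFamily_iff_smul Φ).1 hsep ⟨i₀, x⟩ ⟨i₁, β x⟩ fun τ => by
      rw [CMAlgebra.smul_sigma_mk, CMAlgebra.smul_sigma_mk, CMAlgebra.mem_familyType_iff,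
        CMAlgebra.mem_familyType_iff]
      show τ • x ∈ (Φ i₀).1 ↔ τ • β x ∈ (Φ i₁).1
      rw [← hβ, hall]
    exact h01 (congrArg Sigma.fst heq)
  have key := typeRank_sigmaType_eq_of_pairFlip_pair (G := ℂ ≃+* ℂ) (Φ := fun i => (Φ i).1)
    (fun i => isCMTypeWith_conj (Φ i)) hI h01 hflip hcard hne
  rw [CMAlgebra.isNondegenerateFamily_iff, cmFamilyRank_eq_typeRank_sigmaType, key, Fintype.card_sigma,
    Finset.sum_congr rfl fun i _ => Embeddings.card (K i) ℂ]

end Types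

/-! ## §2 Abelian varieties -/

section Geometry

variable {A : I → AbelianVariety ℂ} {ι : ∀ i, 𝓞 (K i) →+* End (A i)}
  {θ : ∀ i, K i →+* Module.End ℂ (complexBetti (A i).X 1)}

/-- **Two NON-ISOGENOUS CM abelian threefolds whose sextic CM fields both have pair flips: `Hg(A₀ × A₁) = Hg(A₀) ×
Hg(A₁)`** (the family of their types is nondegenerate).  Simplicity is automatic (`isSimple_of_pairFlip`), so the
types separate by Shimura's isogeny theorem. [cite: Gordon1999HodgeAVSurvey, 7.4–7.5]
[cite: Shimura1998, §8.2 Prop. 26] [cite: Dodson1984, §5.1.2 Theorem] -/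
theorem isNondegenerateFamily_pairFlipSextic_pair_of_not_isIsogenous {i₀ i₁ : I} (h01 : i₀ ≠ i₁)
    (hI : ∀ j, j = i₀ ∨ j = i₁)
    (hflip : ∀ (i : I) (s : K i →+* ℂ), ∃ σ : ℂ ≃+* ℂ, σ • s = (starRingAut : ℂ ≃+* ℂ) • s ∧
      ∀ t : K i →+* ℂ, t ≠ s → t ≠ (starRingAut : ℂ ≃+* ℂ) • s → σ • t = t)
    (h6 : ∀ i, finrank ℚ (K i) = 6) (hA : ∀ i, IsCMTypeRealisation (Φ i) (A i) (ι i) (θ i))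
    (hniso : ∀ i j, i ≠ j → ¬AbelianVariety.IsIsogenous (A i) (A j)) : CMAlgebra.IsNondegenerateFamily Φ :=
  isNondegenerateFamily_of_pairFlip_pair h01 hI hflip h6
    (CMAlgebra.isSeparatingFamily_of_isSimple_of_pairwise_not_isIsogenous hA
      (fun i => GenericCMField.isSimple_of_pairFlip (hflip i) (hA i)) hniso)

/-- **The Hodge conjecture on every `A₀^a × A₁^b`** (every `⨁_{j<N} A_{π j}`) of two non-isogenous CM abelian
threefolds whose sextic CM fields both have pair flips, with `B• = D•` there — UNCONDITIONAL; no relation between the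
two fields is assumed (they may coincide). [cite: Gordon1999HodgeAVSurvey, §3 Theorem, 7.5 and 10.10]
[cite: Dodson1984, §5.1.2 Theorem] -/
theorem hodgeConjectureFor_prod_pairFlipSextic_pair {i₀ i₁ : I} (h01 : i₀ ≠ i₁) (hI : ∀ j, j = i₀ ∨ j = i₁)
    (hflip : ∀ (i : I) (s : K i →+* ℂ), ∃ σ : ℂ ≃+* ℂ, σ • s = (starRingAut : ℂ ≃+* ℂ) • s ∧
      ∀ t : K i →+* ℂ, t ≠ s → t ≠ (starRingAut : ℂ ≃+* ℂ) • s → σ • t = t)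
    (h6 : ∀ i, finrank ℚ (K i) = 6) (hA : ∀ i, IsCMTypeRealisation (Φ i) (A i) (ι i) (θ i))
    (hniso : ∀ i j, i ≠ j → ¬AbelianVariety.IsIsogenous (A i) (A j)) {N : ℕ} (π : Fin N → I) :
    HodgeConjectureFor (⨁ fun j : Fin N => A (π j)).dim (⨁ fun j : Fin N => A (π j)).X ∧
      ∀ m : ℕ, hodgeClassSpan (⨁ fun j : Fin N => A (π j)).dim (⨁ fun j : Fin N => A (π j)).X m =
        divisorClassesSpan (⨁ fun j : Fin N => A (π j)).X (⨁ fun j : Fin N => A (π j)).dim m :=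
  have h := isNondegenerateFamily_pairFlipSextic_pair_of_not_isIsogenous h01 hI hflip h6 hA hniso
  ⟨h.hodgeConjectureFor_prod hA π, fun m => h.hodgeClassSpan_prod_eq_divisorClassesSpan hA π m⟩

/-- **No exceptional Hodge class on any `A₀^a × A₁^b`** of two non-isogenous CM abelian threefolds with pair-flip
sextic CM fields. [cite: Gordon1999HodgeAVSurvey, 7.5 and 7.6.1] -/
theorem not_exists_exceptional_prod_pairFlipSextic_pair {i₀ i₁ : I} (h01 : i₀ ≠ i₁) (hI : ∀ j, j = i₀ ∨ j = i₁)
    (hflip : ∀ (i : I) (s : K i →+* ℂ), ∃ σ : ℂ ≃+* ℂ, σ • s = (starRingAut : ℂ ≃+* ℂ) • s ∧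
      ∀ t : K i →+* ℂ, t ≠ s → t ≠ (starRingAut : ℂ ≃+* ℂ) • s → σ • t = t)
    (h6 : ∀ i, finrank ℚ (K i) = 6) (hA : ∀ i, IsCMTypeRealisation (Φ i) (A i) (ι i) (θ i))
    (hniso : ∀ i j, i ≠ j → ¬AbelianVariety.IsIsogenous (A i) (A j)) {N : ℕ} (π : Fin N → I) (m : ℕ) :
    ¬∃ c : complexBetti (⨁ fun j : Fin N => A (π j)).X (2 * m), IsRationalClass c ∧
        IsOfHodgeType (⨁ fun j : Fin N => A (π j)).dim (⨁ fun j : Fin N => A (π j)).X (2 * m) m m c ∧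
        c ∉ divisorClassesSpan (⨁ fun j : Fin N => A (π j)).X (⨁ fun j : Fin N => A (π j)).dim m :=
  (isNondegenerateFamily_pairFlipSextic_pair_of_not_isIsogenous h01 hI hflip h6 hA hniso).not_exists_exceptional_prod
    hA π m

end Geometry

/-! ## §3 By name for sextic CM fields whose Galois closures have degree `24` or `48` -/

section NormalClosure

variable {A : I → AbelianVariety ℂ} {ι : ∀ i, 𝓞 (K i) →+* End (A i)}
  {θ : ∀ i, K i →+* Module.End ℂ (complexBetti (A i).X 1)}

/-- **Two non-isogenous CM abelian threefolds whose sextic CM fields have Galois closures of degree `24` or `48`: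
`Hg(A₀ × A₁) = Hg(A₀) × Hg(A₁)`.** [cite: Dodson1984, §5.1.2 Theorem] [cite: Gordon1999HodgeAVSurvey, 7.4–7.5] -/
theorem isNondegenerateFamily_threefolds_of_finrank_normalClosure {i₀ i₁ : I} (h01 : i₀ ≠ i₁)
    (hI : ∀ j, j = i₀ ∨ j = i₁) (h6 : ∀ i, finrank ℚ (K i) = 6) (L₀ L₁ : Type) [Field L₀] [NumberField L₀]
    [IsNormalClosure ℚ (K i₀) L₀] [Field L₁] [NumberField L₁] [IsNormalClosure ℚ (K i₁) L₁]
    (hL₀ : finrank ℚ L₀ = 24 ∨ finrank ℚ L₀ = 48) (hL₁ : finrank ℚ L₁ = 24 ∨ finrank ℚ L₁ = 48)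
    (hA : ∀ i, IsCMTypeRealisation (Φ i) (A i) (ι i) (θ i))
    (hniso : ∀ i j, i ≠ j → ¬AbelianVariety.IsIsogenous (A i) (A j)) : CMAlgebra.IsNondegenerateFamily Φ := by
  refine isNondegenerateFamily_pairFlipSextic_pair_of_not_isIsogenous h01 hI (fun i => ?_) h6 hA hniso
  rcases hI i with rfl | rfl
  · exact GenericCMField.pairFlip_of_finrank_normalClosure (h6 _) L₀ hL₀
  · exact GenericCMField.pairFlip_of_finrank_normalClosure (h6 _) L₁ hL₁

/-- **The Hodge conjecture on every `A₀^a × A₁^b` of two non-isogenous CM abelian threefolds whose sextic CM fields have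
Galois closures of degree `24` or `48`** (the fields may coincide; the threefolds are automatically simple), with
`B• = D•` there — UNCONDITIONAL. [cite: Gordon1999HodgeAVSurvey, 7.5 and 10.10] [cite: Dodson1984, §5.1.2 Theorem] -/
theorem hodgeConjectureFor_prod_threefolds_of_finrank_normalClosure {i₀ i₁ : I} (h01 : i₀ ≠ i₁)
    (hI : ∀ j, j = i₀ ∨ j = i₁) (h6 : ∀ i, finrank ℚ (K i) = 6) (L₀ L₁ : Type) [Field L₀] [NumberField L₀]
    [IsNormalClosure ℚ (K i₀) L₀] [Field L₁] [NumberField L₁] [IsNormalClosure ℚ (K i₁) L₁]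
    (hL₀ : finrank ℚ L₀ = 24 ∨ finrank ℚ L₀ = 48) (hL₁ : finrank ℚ L₁ = 24 ∨ finrank ℚ L₁ = 48)
    (hA : ∀ i, IsCMTypeRealisation (Φ i) (A i) (ι i) (θ i))
    (hniso : ∀ i j, i ≠ j → ¬AbelianVariety.IsIsogenous (A i) (A j)) {N : ℕ} (π : Fin N → I) :
    HodgeConjectureFor (⨁ fun j : Fin N => A (π j)).dim (⨁ fun j : Fin N => A (π j)).X ∧
      ∀ m : ℕ, hodgeClassSpan (⨁ fun j : Fin N => A (π j)).dim (⨁ fun j : Fin N => A (π j)).X m =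
        divisorClassesSpan (⨁ fun j : Fin N => A (π j)).X (⨁ fun j : Fin N => A (π j)).dim m :=
  have h := isNondegenerateFamily_threefolds_of_finrank_normalClosure h01 hI h6 L₀ L₁ hL₀ hL₁ hA hniso
  ⟨h.hodgeConjectureFor_prod hA π, fun m => h.hodgeClassSpan_prod_eq_divisorClassesSpan hA π m⟩

/-- **The Hodge conjecture on every `A₀^a × A₁^b` of two simple CM abelian threefolds, `K_{i₁}` with Galois closure of
degree `24` or `48` and `K_{i₀}` containing an imaginary quadratic field `k`** (cyclic sextic, or closure of degree
`12`), with `B• = D•` — UNCONDITIONAL (file F2 by name). [cite: Gordon1999HodgeAVSurvey, 7.5 and 10.10]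
[cite: Dodson1984, §5.1.2 Theorem] -/
theorem hodgeConjectureFor_prod_threefolds_of_finrank_normalClosure_of_quadratic {i₀ i₁ : I} (h01 : i₀ ≠ i₁)
    (hI : ∀ j, j = i₀ ∨ j = i₁) (h6 : ∀ i, finrank ℚ (K i) = 6) (L₁ : Type) [Field L₁] [NumberField L₁]
    [IsNormalClosure ℚ (K i₁) L₁] (hL₁ : finrank ℚ L₁ = 24 ∨ finrank ℚ L₁ = 48) {k : Type} [Field k]
    [NumberField k] [IsTotallyComplex k] (hk : finrank ℚ k = 2) (jk : k →+* K i₀)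
    (hA : ∀ i, IsCMTypeRealisation (Φ i) (A i) (ι i) (θ i)) (hS : (A i₀).IsSimple) {N : ℕ} (π : Fin N → I) :
    HodgeConjectureFor (⨁ fun j : Fin N => A (π j)).dim (⨁ fun j : Fin N => A (π j)).X ∧
      ∀ m : ℕ, hodgeClassSpan (⨁ fun j : Fin N => A (π j)).dim (⨁ fun j : Fin N => A (π j)).X m =
        divisorClassesSpan (⨁ fun j : Fin N => A (π j)).X (⨁ fun j : Fin N => A (π j)).dim m :=
  hodgeConjectureFor_prod_pairFlipSextic_simpleThreefold_of_quadratic h01 hI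
    (GenericCMField.pairFlip_of_finrank_normalClosure (h6 i₁) L₁ hL₁) h6 hk jk hA hS π

/-- **The Hodge conjecture on every `A₀^a × A₁^b` of a CM elliptic curve or simple CM abelian surface `A₀` and a CM
abelian threefold `A₁` whose sextic CM field has Galois closure of degree `24` or `48`**, with `B• = D•` — UNCONDITIONAL
(file F2 by name). [cite: Gordon1999HodgeAVSurvey, §3 Theorem and 10.10] [cite: MoonenZarhin1999LowDim, Cor. (3.9)] -/
theorem hodgeConjectureFor_prod_small_threefold_of_finrank_normalClosure {i₀ i₁ : I} (h01 : i₀ ≠ i₁)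
    (hI : ∀ j, j = i₀ ∨ j = i₁) (h6 : finrank ℚ (K i₁) = 6) (h4 : finrank ℚ (K i₀) ≤ 4) (L₁ : Type) [Field L₁]
    [NumberField L₁] [IsNormalClosure ℚ (K i₁) L₁] (hL₁ : finrank ℚ L₁ = 24 ∨ finrank ℚ L₁ = 48)
    (hA : ∀ i, IsCMTypeRealisation (Φ i) (A i) (ι i) (θ i)) (hS : (A i₀).IsSimple) {N : ℕ} (π : Fin N → I) :
    HodgeConjectureFor (⨁ fun j : Fin N => A (π j)).dim (⨁ fun j : Fin N => A (π j)).X ∧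
      ∀ m : ℕ, hodgeClassSpan (⨁ fun j : Fin N => A (π j)).dim (⨁ fun j : Fin N => A (π j)).X m =
        divisorClassesSpan (⨁ fun j : Fin N => A (π j)).X (⨁ fun j : Fin N => A (π j)).dim m :=
  hodgeConjectureFor_prod_pairFlipSextic_simple_of_finrank_le_four h01 hI
    (GenericCMField.pairFlip_of_finrank_normalClosure h6 L₁ hL₁) h6 h4 hA hS π

end NormalClosure

end Summit.HodgeConjecture.CorCM

end
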